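import Summits.HubbardSuperconductivity.HubbardSuperconductivity.Theorems.BalabanIRBirBdGPhaseCoercivityFourier
import Literature.Computability.AlgebraicComplexity.QuantumFunctionalSpectral
import HarnessLib

/-!
# Crux `BirBdGPhaseCoercivity` (stmt-HubbardSuperconductivity-2081, route `BalabanIR`), line
`bcs-dual-persistence` (reshaped, `V := K`) — stub `stub_sumAbsEig_hat` (S4, spectral sum along the
scaled plane-wave conjugation)

If `Wᴴ W = W Wᴴ = N·1` (`N ≠ 0`) and `X^ = N⁻¹ (W ⊕ W) X (W ⊕ W)ᴴ` then `Σ_i |λ_i(X)| = Σ_i |λ_i(X^)|`: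
`V := (√N)⁻¹ (W ⊕ W)` satisfies `Vᴴ V = 1` (`BirBdG.fromBlocks_conjTranspose_mul_self`) and
`V X Vᴴ = X^`, so `Literature.Computability.AlgebraicComplexity.sum_eigenvalues_isometry_conj`
(with `f = |·|`, `f 0 = 0`) applies; the eigenvalue function of `X^` does not depend on the Hermitian
proof (`Literature.MathematicalPhysics.QuantumLattice.eigenvalues_eq_of_eq` / proof irrelevance).
No definition is introduced. [folklore]
-/

noncomputable section

set_option linter.dupNamespace false

namespace Summit.HubbardSuperconductivity.HubbardSuperconductivity.Theorems.BirBdGPhaseCoercivity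

open Matrix Finset Summit.HubbardSuperconductivity.HubbardSuperconductivity.Theorems.BirBdG
open scoped ComplexConjugate ComplexOrder

/-- Conjugation by an isometry `V` (`Vᴴ V = 1`) does not change the spectral sum `Σ|λ|`; the
eigenvalue function of `V X Vᴴ = Y` does not depend on the Hermitian proof. [folklore] -/
private theorem sum_abs_eigenvalues_conj_eq {n : Type*} [Fintype n] [DecidableEq n]
    {X Y : Matrix n n ℂ} (V : Matrix n n ℂ) (hV : Vᴴ * V = 1) (hmat : V * X * Vᴴ = Y)
    (hX : X.IsHermitian) (hY : Y.IsHermitian) :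
    ∑ i, |hX.eigenvalues i| = ∑ i, |hY.eigenvalues i| := by
  subst hmat
  exact (Literature.Computability.AlgebraicComplexity.sum_eigenvalues_isometry_conj
    (f := fun x : ℝ => |x|) hX V hV hY (by simp)).symm

/-- **The spectral sum `Σ|λ|` is invariant under the scaled plane-wave conjugation**
`X ↦ N⁻¹ (W⊕W) X (W⊕W)ᴴ`, `Wᴴ W = W Wᴴ = N`: `V := (√N)⁻¹ (W⊕W)` is an isometry with
`V X Vᴴ = N⁻¹ (W⊕W) X (W⊕W)ᴴ`. [folklore] -/
theorem stub_sumAbsEig_hat {m : Type*} [Fintype m] [DecidableEq m] {W : Matrix m m ℂ} {N : ℕ}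
    (hN : N ≠ 0) (h1 : Wᴴ * W = (N : ℂ) • (1 : Matrix m m ℂ))
    (_h2 : W * Wᴴ = (N : ℂ) • (1 : Matrix m m ℂ)) (X Xh : Matrix (m ⊕ m) (m ⊕ m) ℂ)
    (hXh : (N : ℂ)⁻¹ • (Matrix.fromBlocks W 0 0 W * X * (Matrix.fromBlocks W 0 0 W)ᴴ) = Xh)
    (hX : X.IsHermitian) (hXh' : Xh.IsHermitian) :
    ∑ i, |hX.eigenvalues i| = ∑ i, |hXh'.eigenvalues i| := by
  have hN' : (N : ℂ) ≠ 0 := Nat.cast_ne_zero.2 hN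
  -- the real scaling constant `c = (√N)⁻¹`, with `c̄ = c` and `c² = N⁻¹`
  obtain ⟨c, hc⟩ : ∃ c : ℝ, c = ((N : ℝ).sqrt)⁻¹ := ⟨_, rfl⟩
  have hcc : (c : ℂ) * c = (N : ℂ)⁻¹ := by
    rw [← Complex.ofReal_mul, hc, ← mul_inv, Real.mul_self_sqrt (Nat.cast_nonneg N),
      Complex.ofReal_inv, Complex.ofReal_natCast]
  have hstar : star (c : ℂ) = c := Complex.conj_ofReal c
  refine sum_abs_eigenvalues_conj_eq ((c : ℂ) • Matrix.fromBlocks W 0 0 W) ?_ ?_ hX hXh'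
  · -- `Vᴴ V = c̄ c (W⊕W)ᴴ (W⊕W) = N⁻¹ N = 1`
    rw [Matrix.conjTranspose_smul, Matrix.smul_mul, Matrix.mul_smul, smul_smul,
      fromBlocks_conjTranspose_mul_self h1, smul_smul, hstar, hcc, inv_mul_cancel₀ hN', one_smul]
  · -- `V X Vᴴ = c c̄ (W⊕W) X (W⊕W)ᴴ = X^`
    rw [← hXh, Matrix.conjTranspose_smul, Matrix.mul_smul, Matrix.smul_mul, Matrix.smul_mul,
      smul_smul, hstar, hcc]

end Summit.HubbardSuperconductivity.HubbardSuperconductivity.Theorems.BirBdGPhaseCoercivity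

end
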